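import Literature.Topology.PlaneTopology.CrosscutProofs
import Literature.Topology.PlaneTopology.SimpleArcs
import Literature.Probability.RandomPlanarGeometry.PlanarDomains
import Mathlib.Analysis.Convex.PathConnected
import Mathlib.Analysis.Complex.Convex
import HarnessLib

/-!
# Radó squeezes, part 1: the model half-disc, its collars, cuts and boundary paths

Support file (`--supports stmt-CriticalPhenomena-0773`, towards the registered stub `stub_radoSqueezeFamily`,
geometry F′ of the line `birth` for the crux `RestrictionOfLimit`). Elementary plane geometry only.

The boundary-controlled outer squeeze of a Jordan sub-domain `D' ⊆ D` is built by transporting, into each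
defect component (a Jordan domain bounded by a free arc of `∂D'` and an arc of `∂D`), a MODEL picture drawn
in the open upper half unit disc `H = {‖z‖ < 1, 0 < im z}`: the free arc corresponds to the base diameter
`[1, -1]` (path `bPar`), the arc of `∂D` to the upper unit semicircle (path `qPar`), the removed BITE at
level `η` is `{‖z‖ ≤ 1, η ≤ im z}`, cut off by the chord `{‖z‖ ≤ 1, im z = η}`, and the boundary of the
kept collar runs along the 3-piece path `pPar η` (up the semicircle from `1` to height `η`, along the chord,
down the semicircle to `-1`), which is a simple arc within distance `6η` of the base path. This file
records these objects and their elementary properties, and packages `H` as a `JordanDomain` (its frontier,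
the base diameter followed by the semicircle, is a Jordan curve by the two-arcs lemma of the tree).

References: Ch. Pommerenke, *Boundary Behaviour of Conformal Maps* (1992), §2 (Jordan domains). Axioms
`propext`, `Classical.choice`, `Quot.sound`.
-/

noncomputable section

open Set Filter Topology Metric Complex
open Literature.Topology.PlaneTopology Literature.Probability.RandomPlanarGeometry

namespace Summit.CriticalPhenomena.SAWScalingLimit.Theorems.RestrictionOfLimit.Birth

/-! ### Points of the closed half-disc as limits of interior points -/

/-- **Thin collars are dense up to the boundary.** Every point of `{‖z‖ ≤ 1, 0 ≤ im z ≤ η}` is a limit of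
points of the open thin collar `{‖z‖ < 1, 0 < im z < η}` (`0 < η < 2`). [folklore] -/
theorem mem_closure_thinCollar {η : ℝ} (hη : 0 < η) (hη2 : η < 2) {z : ℂ} (hz : ‖z‖ ≤ 1) (h0 : 0 ≤ z.im)
    (h1 : z.im ≤ η) : z ∈ closure {w : ℂ | ‖w‖ < 1 ∧ 0 < w.im ∧ w.im < η} := by
  set f : ℝ → ℂ := fun ε ↦ ((1 - ε : ℝ) : ℂ) * z + ((ε * (1 - ε) * (η / 2) : ℝ) : ℂ) * I with hf
  have hfc : Continuous f := by
    simp only [hf]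
    fun_prop
  have hf0 : f 0 = z := by simp [hf]
  have htend : Tendsto f (𝓝[>] 0) (𝓝 z) := by
    rw [← hf0]
    exact (hfc.tendsto 0).mono_left nhdsWithin_le_nhds
  refine mem_closure_of_tendsto htend ?_
  have hI : Ioo (0 : ℝ) 1 ∈ 𝓝[>] (0 : ℝ) := Ioo_mem_nhdsGT one_pos
  filter_upwards [hI] with ε hε
  have hε0 : 0 < ε := hε.1
  have hε1 : ε < 1 := hε.2
  have him : (f ε).im = (1 - ε) * z.im + ε * (1 - ε) * (η / 2) := by
    simp [hf]
  refine ⟨?_, ?_, ?_⟩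
  · calc ‖f ε‖ ≤ ‖((1 - ε : ℝ) : ℂ) * z‖ + ‖((ε * (1 - ε) * (η / 2) : ℝ) : ℂ) * I‖ := norm_add_le _ _
      _ = (1 - ε) * ‖z‖ + ε * (1 - ε) * (η / 2) := by
          rw [norm_mul, norm_mul, norm_I, mul_one, Complex.norm_real, Complex.norm_real,
            Real.norm_of_nonneg (by linarith), Real.norm_of_nonneg (by positivity)]
      _ ≤ (1 - ε) * 1 + ε * (1 - ε) * (η / 2) := by gcongr
      _ < 1 := by nlinarith [mul_pos hε0 (sub_pos.2 hε1)]
  · rw [him]; nlinarith [mul_pos hε0 (sub_pos.2 hε1), mul_nonneg (sub_pos.2 hε1).le h0]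
  · rw [him]
    calc (1 - ε) * z.im + ε * (1 - ε) * (η / 2) ≤ (1 - ε) * η + ε * (1 - ε) * (η / 2) := by
          gcongr
      _ < η := by nlinarith [mul_pos hε0 hη, mul_pos (mul_pos hε0 hε0) hη]

/-- Every point of `{‖z‖ ≤ 1, η ≤ im z}` off the unit circle or at height exactly... more precisely every
point `z` with `‖z‖ ≤ 1` and `η ≤ im z` such that `‖z‖ < 1 ∨ im z = η`... we only need: the two corners
`±√(1-η²) + ηi` and all points of `{‖z‖ < 1, η ≤ im}` are limits of points of the open bite
`{‖z‖ < 1, η < im z}`; here is the corner case, for any point of the closed disc at height `η`. [folklore] -/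
theorem mem_closure_openBite {η : ℝ} (hη : 0 < η) (hη1 : η < 1) {z : ℂ} (hz : ‖z‖ ≤ 1) (h1 : z.im = η) :
    z ∈ closure {w : ℂ | ‖w‖ < 1 ∧ η < w.im} := by
  set f : ℝ → ℂ := fun ε ↦ ((1 - ε : ℝ) : ℂ) * (z + (ε : ℂ) * I) with hf
  have hfc : Continuous f := by
    simp only [hf]
    fun_prop
  have hf0 : f 0 = z := by simp [hf]
  have htend : Tendsto f (𝓝[>] 0) (𝓝 z) := by
    rw [← hf0]
    exact (hfc.tendsto 0).mono_left nhdsWithin_le_nhds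
  refine mem_closure_of_tendsto htend ?_
  have hI : Ioo (0 : ℝ) (1 - η) ∈ 𝓝[>] (0 : ℝ) := Ioo_mem_nhdsGT (by linarith)
  filter_upwards [hI] with ε hε
  have hε0 : 0 < ε := hε.1
  have hε1 : ε < 1 - η := hε.2
  refine ⟨?_, ?_⟩
  · calc ‖f ε‖ = (1 - ε) * ‖z + (ε : ℂ) * I‖ := by
          rw [hf, norm_mul, Complex.norm_real, Real.norm_of_nonneg (by linarith)]
      _ ≤ (1 - ε) * (‖z‖ + ‖(ε : ℂ) * I‖) := mul_le_mul_of_nonneg_left (norm_add_le _ _) (by linarith)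
      _ = (1 - ε) * (‖z‖ + ε) := by rw [norm_mul, norm_I, mul_one, Complex.norm_real, Real.norm_of_nonneg hε0.le]
      _ ≤ (1 - ε) * (1 + ε) := by gcongr; linarith
      _ < 1 := by nlinarith
  · have : (f ε).im = (1 - ε) * (η + ε) := by simp [hf, h1]
    rw [this]
    nlinarith

/-! ### The base path and the semicircle path -/

/-- The **base path** `u ↦ 1 - 2u`: the diameter of the model half-disc from `1` to `-1`. [folklore] -/
def bPar (u : ℝ) : ℂ := ((1 - 2 * u : ℝ) : ℂ)

/-- The **semicircle path** `u ↦ (1 - 2u) + i√(1 - (1 - 2u)²)`: the upper unit semicircle from `1` to `-1`,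
as a graph over the base. [folklore] -/
def qPar (u : ℝ) : ℂ := ((1 - 2 * u : ℝ) : ℂ) + ((Real.sqrt (1 - (1 - 2 * u) ^ 2) : ℝ) : ℂ) * I

/-- The base path is continuous. [folklore] -/
theorem continuous_bPar : Continuous bPar := by unfold bPar; fun_prop

/-- The semicircle path is continuous. [folklore] -/
theorem continuous_qPar : Continuous qPar := by unfold qPar; fun_prop

/-- Real and imaginary parts of the base path. [folklore] -/
@[simp] theorem bPar_re_im (u : ℝ) : (bPar u).re = 1 - 2 * u ∧ (bPar u).im = 0 := by simp [bPar]

/-- Real part of the semicircle path. [folklore] -/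
theorem qPar_re (u : ℝ) : (qPar u).re = 1 - 2 * u := by simp [qPar]

/-- Imaginary part of the semicircle path. [folklore] -/
theorem qPar_im (u : ℝ) : (qPar u).im = Real.sqrt (1 - (1 - 2 * u) ^ 2) := by simp [qPar]

/-- End-points of the base path. [folklore] -/
theorem bPar_zero_one : bPar 0 = 1 ∧ bPar 1 = -1 := by
  constructor
  · simp [bPar]
  · simp [bPar]; norm_num

/-- End-points of the semicircle path. [folklore] -/
theorem qPar_zero_one : qPar 0 = 1 ∧ qPar 1 = -1 := by
  constructor
  · simp [qPar]
  · simp [qPar]; norm_num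

/-- The base path is injective. [folklore] -/
theorem bPar_injective : Function.Injective bPar := fun u v h ↦ by
  have := congrArg Complex.re h
  simp [bPar] at this
  linarith

/-- The semicircle path is injective (its real part is). [folklore] -/
theorem qPar_injective : Function.Injective qPar := fun u v h ↦ by
  have := congrArg Complex.re h
  rw [qPar_re, qPar_re] at this
  linarith

/-- On `[0, 1]` the semicircle path lies on the unit circle, in the closed upper half-plane. [folklore] -/
theorem norm_qPar {u : ℝ} (hu : u ∈ Icc (0 : ℝ) 1) : ‖qPar u‖ = 1 ∧ 0 ≤ (qPar u).im := by
  have hx : (1 - 2 * u) ^ 2 ≤ 1 := by nlinarith [hu.1, hu.2]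
  refine ⟨?_, by rw [qPar_im]; exact Real.sqrt_nonneg _⟩
  rw [qPar, norm_add_mul_I, Real.sq_sqrt (by linarith), add_sub_cancel, Real.sqrt_one]

/-- Strictly inside `(0, 1)` the semicircle path lies in the open upper half-plane. [folklore] -/
theorem qPar_im_pos {u : ℝ} (hu : u ∈ Ioo (0 : ℝ) 1) : 0 < (qPar u).im := by
  rw [qPar_im]
  exact Real.sqrt_pos.2 (by nlinarith [hu.1, hu.2])

/-- The base path on `[0, 1]` stays in the closed unit disc, on the real axis. [folklore] -/
theorem norm_bPar_le {u : ℝ} (hu : u ∈ Icc (0 : ℝ) 1) : ‖bPar u‖ ≤ 1 := by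
  rw [bPar, Complex.norm_real, Real.norm_eq_abs, abs_le]
  constructor <;> linarith [hu.1, hu.2]

/-- **The upper unit semicircle is the range of the semicircle path on `[0, 1]`.** [folklore] -/
theorem image_qPar : qPar '' Icc 0 1 = {z : ℂ | ‖z‖ = 1 ∧ 0 ≤ z.im} := by
  ext z
  constructor
  · rintro ⟨u, hu, rfl⟩
    exact norm_qPar hu
  · rintro ⟨hz1, hz0⟩
    have hsq : z.re ^ 2 + z.im ^ 2 = 1 := by
      have h := Complex.sq_norm z
      rw [hz1, Complex.normSq_apply] at h
      nlinarith [h]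
    have hre : z.re ^ 2 ≤ 1 := by nlinarith
    refine ⟨(1 - z.re) / 2, ⟨by nlinarith, by nlinarith⟩, ?_⟩
    apply Complex.ext
    · rw [qPar_re]; ring
    · rw [qPar_im, show 1 - 2 * ((1 - z.re) / 2) = z.re by ring]
      rw [show 1 - z.re ^ 2 = z.im ^ 2 by linarith, Real.sqrt_sq hz0]

/-- **The base diameter is the range of the base path on `[0, 1]`.** [folklore] -/
theorem image_bPar : bPar '' Icc 0 1 = {z : ℂ | z.im = 0 ∧ |z.re| ≤ 1} := by
  ext z
  constructor
  · rintro ⟨u, hu, rfl⟩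
    refine ⟨(bPar_re_im u).2, ?_⟩
    rw [(bPar_re_im u).1, abs_le]
    constructor <;> linarith [hu.1, hu.2]
  · rintro ⟨hz0, hz1⟩
    rw [abs_le] at hz1
    refine ⟨(1 - z.re) / 2, ⟨by linarith, by linarith⟩, ?_⟩
    apply Complex.ext
    · rw [(bPar_re_im _).1]; ring
    · rw [(bPar_re_im _).2, hz0]

/-- The base diameter is a simple arc from `1` to `-1`. [folklore] -/
theorem isSimpleArc_base : IsSimpleArc {z : ℂ | z.im = 0 ∧ |z.re| ≤ 1} 1 (-1) :=
  ⟨bPar, continuous_bPar.continuousOn, bPar_injective.injOn, image_bPar, bPar_zero_one.1, bPar_zero_one.2⟩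

/-- The upper unit semicircle is a simple arc from `1` to `-1`. [folklore] -/
theorem isSimpleArc_semicircle : IsSimpleArc {z : ℂ | ‖z‖ = 1 ∧ 0 ≤ z.im} 1 (-1) :=
  ⟨qPar, continuous_qPar.continuousOn, qPar_injective.injOn, image_qPar, qPar_zero_one.1, qPar_zero_one.2⟩

/-! ### The model half-disc as a Jordan domain -/

/-- **Closure of the open upper half unit disc.** [folklore] -/
theorem closure_halfDisc : closure {z : ℂ | ‖z‖ < 1 ∧ 0 < z.im} = {z : ℂ | ‖z‖ ≤ 1 ∧ 0 ≤ z.im} := by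
  refine Subset.antisymm ?_ fun z hz ↦ ?_
  · refine closure_minimal (fun z hz ↦ ⟨hz.1.le, hz.2.le⟩) ?_
    exact (isClosed_le continuous_norm continuous_const).inter (isClosed_le continuous_const continuous_im)
  · have hz2 : z.im ≤ 1 := (abs_le.1 ((Complex.abs_im_le_norm z).trans hz.1)).2
    have h3 : (3 : ℝ) / 2 < 2 := by norm_num
    have h4 : z.im ≤ 3 / 2 := hz2.trans (by norm_num)
    refine closure_mono ?_ (mem_closure_thinCollar (by norm_num : (0 : ℝ) < 3 / 2) h3 hz.1 hz.2 h4)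
    exact fun w hw ↦ ⟨hw.1, hw.2.1⟩

/-- **Frontier of the open upper half unit disc**: the base diameter together with the upper semicircle.
[folklore] -/
theorem frontier_halfDisc : frontier {z : ℂ | ‖z‖ < 1 ∧ 0 < z.im} =
    {z : ℂ | z.im = 0 ∧ |z.re| ≤ 1} ∪ {z : ℂ | ‖z‖ = 1 ∧ 0 ≤ z.im} := by
  have hopen : IsOpen {z : ℂ | ‖z‖ < 1 ∧ 0 < z.im} :=
    (isOpen_lt continuous_norm continuous_const).inter (isOpen_lt continuous_const continuous_im)
  rw [frontier, hopen.interior_eq, closure_halfDisc]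
  ext z
  constructor
  · rintro ⟨⟨h1, h0⟩, hnot⟩
    rcases h1.lt_or_eq with h1 | h1
    · left
      have him : z.im = 0 := by
        by_contra hne
        exact hnot ⟨h1, lt_of_le_of_ne h0 (Ne.symm hne)⟩
      refine ⟨him, ?_⟩
      have := Complex.abs_re_le_norm z
      linarith
    · exact Or.inr ⟨h1, h0⟩
  · rintro (⟨h0, h1⟩ | ⟨h1, h0⟩)
    · have hn : ‖z‖ = |z.re| := by
        rw [← Complex.re_add_im z, h0]
        simp
      exact ⟨⟨hn ▸ h1, h0.ge⟩, fun h ↦ absurd h0 h.2.ne'⟩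
    · exact ⟨⟨h1.le, h0⟩, fun h ↦ absurd h1 h.1.ne⟩

/-- **The model half-disc is a Jordan domain**: there is a `JordanDomain` with carrier the open upper half
unit disc (its boundary loop runs through the base diameter and the upper semicircle). [folklore] -/
theorem exists_halfDisc : ∃ M : JordanDomain, M.carrier = {z : ℂ | ‖z‖ < 1 ∧ 0 < z.im} := by
  have hinter : {z : ℂ | z.im = 0 ∧ |z.re| ≤ 1} ∩ {z : ℂ | ‖z‖ = 1 ∧ 0 ≤ z.im} ⊆ {1, -1} := by
    rintro z ⟨⟨h0, -⟩, h1, -⟩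
    have hre : z.re = 1 ∨ z.re = -1 := by
      have h := Complex.sq_norm z
      rw [h1, Complex.normSq_apply, h0] at h
      have : (z.re - 1) * (z.re + 1) = 0 := by nlinarith
      rcases mul_eq_zero.1 this with h | h
      · left; linarith
      · right; linarith
    rcases hre with h | h
    · left; exact Complex.ext (by simp [h]) (by simp [h0])
    · right; exact Complex.ext (by simp [h]) (by simp [h0])
  obtain ⟨γ, hγc, hγp, hγi, hγr⟩ := isSimpleArc_base.exists_periodic_of_union isSimpleArc_semicircle.symm hinter
  have hopen : IsOpen {z : ℂ | ‖z‖ < 1 ∧ 0 < z.im} :=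
    (isOpen_lt continuous_norm continuous_const).inter (isOpen_lt continuous_const continuous_im)
  have hconv : Convex ℝ {z : ℂ | ‖z‖ < 1 ∧ 0 < z.im} := by
    have h1 : Convex ℝ (ball (0 : ℂ) 1) := convex_ball 0 1
    have h2 : Convex ℝ {z : ℂ | 0 < z.im} := convex_halfSpace_im_gt 0
    have : {z : ℂ | ‖z‖ < 1 ∧ 0 < z.im} = ball (0 : ℂ) 1 ∩ {z : ℂ | 0 < z.im} := by
      ext z; simp
    rw [this]
    exact h1.inter h2
  have hne : ({z : ℂ | ‖z‖ < 1 ∧ 0 < z.im}).Nonempty :=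
    ⟨(1 / 2 : ℂ) * I, by norm_num, by simp⟩
  refine ⟨⟨{z : ℂ | ‖z‖ < 1 ∧ 0 < z.im}, γ, hopen, ?_, ⟨hne, hconv.isPreconnected⟩, hγc, hγp, hγi, ?_⟩, rfl⟩
  · exact (isBounded_ball (x := (0 : ℂ)) (r := 1)).subset fun z hz ↦ mem_ball_zero_iff.2 hz.1
  · rw [hγr, frontier_halfDisc]

/-! ### Bites and cuts -/

/-- The chord `{‖z‖ ≤ 1, im z = η}` is a simple arc between the two corners `±√(1 - η²) + ηi`
(`0 < η < 1`). [folklore] -/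
theorem isSimpleArc_chord {η : ℝ} (hη : 0 < η) (hη1 : η < 1) :
    IsSimpleArc {z : ℂ | ‖z‖ ≤ 1 ∧ z.im = η} (((Real.sqrt (1 - η ^ 2) : ℝ) : ℂ) + (η : ℂ) * I)
      (((-Real.sqrt (1 - η ^ 2) : ℝ) : ℂ) + (η : ℂ) * I) := by
  set r : ℝ := Real.sqrt (1 - η ^ 2) with hr
  have hr0 : 0 < r := Real.sqrt_pos.2 (by nlinarith)
  have hrr : r ^ 2 = 1 - η ^ 2 := Real.sq_sqrt (by nlinarith)
  refine ⟨fun u ↦ ((r * (1 - 2 * u) : ℝ) : ℂ) + (η : ℂ) * I, by fun_prop, ?_, ?_,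
    by push_cast; ring, by push_cast; ring⟩
  · intro u _ v _ h
    have := congrArg Complex.re h
    simp only [add_re, ofReal_re, mul_re, I_re, mul_zero, ofReal_im, I_im, mul_one, sub_self,
      add_zero] at this
    nlinarith [this, hr0]
  · ext z
    constructor
    · rintro ⟨u, hu, rfl⟩
      refine ⟨?_, by simp⟩
      rw [norm_add_mul_I, Real.sqrt_le_one]
      have : (1 - 2 * u) ^ 2 ≤ 1 := by nlinarith [hu.1, hu.2]
      nlinarith
    · rintro ⟨hz1, hzη⟩
      have hsq : z.re ^ 2 ≤ r ^ 2 := by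
        have h := Complex.sq_norm z
        rw [Complex.normSq_apply, hzη] at h
        nlinarith [norm_nonneg z]
      have hre : -r ≤ z.re ∧ z.re ≤ r := abs_le_of_sq_le_sq' hsq hr0.le
      refine ⟨(1 - z.re / r) / 2, ⟨?_, ?_⟩, ?_⟩
      · have : z.re / r ≤ 1 := (div_le_one hr0).2 hre.2
        linarith
      · have : -1 ≤ z.re / r := (le_div_iff₀ hr0).2 (by linarith)
        linarith
      · apply Complex.ext
        · simp only [add_re, ofReal_re, mul_re, I_re, mul_zero, ofReal_im, I_im, mul_one, sub_self,
            add_zero]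
          field_simp
          ring
        · simp [hzη]

/-- The open bite `{‖z‖ < 1, η < im z}` is open, convex and nonempty (`η < 1`). [folklore] -/
theorem isOpen_convex_openBite {η : ℝ} (hη1 : η < 1) :
    IsOpen {z : ℂ | ‖z‖ < 1 ∧ η < z.im} ∧ Convex ℝ {z : ℂ | ‖z‖ < 1 ∧ η < z.im} ∧
      ({z : ℂ | ‖z‖ < 1 ∧ η < z.im}).Nonempty := by
  refine ⟨(isOpen_lt continuous_norm continuous_const).inter (isOpen_lt continuous_const continuous_im),
    ?_, ?_⟩
  · have : {z : ℂ | ‖z‖ < 1 ∧ η < z.im} = ball (0 : ℂ) 1 ∩ {z : ℂ | η < z.im} := by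
      ext z; simp
    rw [this]
    exact (convex_ball 0 1).inter (convex_halfSpace_im_gt η)
  · refine ⟨(((1 + max η 0) / 2 : ℝ) : ℂ) * I, ?_, ?_⟩
    · rw [norm_mul, norm_I, mul_one, Complex.norm_real, Real.norm_of_nonneg (by positivity)]
      have := max_lt hη1 one_pos
      linarith
    · simp only [mul_im, ofReal_re, I_im, mul_one, ofReal_im, I_re, mul_zero, add_zero]
      have := le_max_left η 0
      have h2 := max_lt hη1 one_pos
      linarith

/-- Points of the chord other than its two corners lie in the open half-disc. [folklore] -/
theorem chord_diff_corners_subset {η : ℝ} (hη : 0 < η) {z : ℂ} (hz : ‖z‖ ≤ 1) (hzη : z.im = η)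
    (h1 : z ≠ ((Real.sqrt (1 - η ^ 2) : ℝ) : ℂ) + (η : ℂ) * I)
    (h2 : z ≠ ((-Real.sqrt (1 - η ^ 2) : ℝ) : ℂ) + (η : ℂ) * I) : ‖z‖ < 1 ∧ 0 < z.im := by
  refine ⟨lt_of_le_of_ne hz fun h ↦ ?_, hzη ▸ hη⟩
  have hsq : z.re ^ 2 = 1 - η ^ 2 := by
    have h' := Complex.sq_norm z
    rw [h, Complex.normSq_apply, hzη] at h'
    nlinarith
  have h1η : 0 ≤ 1 - η ^ 2 := by
    have := Complex.sq_norm z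
    rw [h, Complex.normSq_apply, hzη] at this
    nlinarith
  have hss : Real.sqrt (1 - η ^ 2) * Real.sqrt (1 - η ^ 2) = 1 - η ^ 2 := Real.mul_self_sqrt h1η
  rcases mul_self_eq_mul_self_iff.1 (show z.re * z.re = Real.sqrt (1 - η ^ 2) * Real.sqrt (1 - η ^ 2) by
    rw [hss]; nlinarith [hsq]) with h' | h'
  · exact h1 (Complex.ext (by simp [h']) (by simp [hzη]))
  · exact h2 (Complex.ext (by simp [h']) (by simp [hzη]))

/-- **Registered helper stub `stub_radoModel`** (towards `stub_radoSqueezeFamily`, line `birth`): the model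
half-disc is a Jordan domain, with frontier the base diameter followed by the upper semicircle. [folklore] -/
theorem stub_radoModel :
    (∃ M : JordanDomain, M.carrier = {z : ℂ | ‖z‖ < 1 ∧ 0 < z.im}) ∧
      frontier {z : ℂ | ‖z‖ < 1 ∧ 0 < z.im} = {z : ℂ | z.im = 0 ∧ |z.re| ≤ 1} ∪ {z : ℂ | ‖z‖ = 1 ∧ 0 ≤ z.im} :=
  ⟨exists_halfDisc, frontier_halfDisc⟩

end Summit.CriticalPhenomena.SAWScalingLimit.Theorems.RestrictionOfLimit.Birth

end
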